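import Summits.ABC.ABC.Theorems.PrimePowerRadical.Negative.WithoutEps

/-!
# `PrimePowerRadical` (stmt-ABC-1648): the explicit-constant floor inside the family is `1.4557…`

Negative support (cdisprove seat). With the constant fixed to `C = 1`, the inequality
`q^k < rad(1·(q^k−1)·q^k)^θ` fails for every `θ ≤ 29/20` at the abc triple `(1, 2400, 2401) = (1, 7^4 − 1, 7^4)`
(`rad = 2·3·5·7 = 210`, quality `log 2401 / log 210 = 1.4557…`, the record of the family in every range computed).
So an explicit-constant form of the crux needs an exponent `> 1.4557` on this family alone; compare the floor
`1.6299` (Reyssat's triple) for abc at large, `Literature.Barriers.ABC.ExplicitABCQualityFloor`, and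
`Negative/Tightness.lean` (`not_const_one`: `(1,8,9)` already kills `θ = 6/5`).
-/

noncomputable section

namespace Summit.ABC.ABC.Theorems.PrimePowerRadical.Negative

open Literature.NumberTheory.DiophantineGeometry UniqueFactorizationMonoid

/-- `rad(2400) = rad(2^5 · 3 · 5^2) = 30`. [folklore] -/
theorem radical_2400 : radical (2400 : ℕ) = 30 := by
  rw [Nat.radical_eq_prod_primeFactors, ← Nat.toFinset_factors]
  simp [Nat.primeFactorsList_ofNat]

/-- `rad(1 · 2400 · 2401) = 210` (the abc triple `1 + 2400 = 7^4`). [folklore] -/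
theorem rad_one_2400_2401 : rad 1 2400 2401 = 210 := by
  have h := rad_family_eq (q := 7) (k := 4) (by norm_num) (by norm_num)
  norm_num at h
  rw [h, radical_2400]

/-- `210^{29/20} < 2401` (i.e. `210^{29} < 2401^{20} = 7^{80}`). [folklore] -/
theorem rpow_210_lt_2401 : (210 : ℝ) ^ ((29 : ℝ) / 20) < 2401 := by
  set t : ℝ := (210 : ℝ) ^ ((29 : ℝ) / 20) with ht
  have ht20 : t ^ 20 = (210 : ℝ) ^ (29 : ℕ) := by
    rw [ht, ← Real.rpow_natCast, ← Real.rpow_mul (by norm_num)]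
    norm_num
  refine lt_of_pow_lt_pow_left₀ 20 (by norm_num) ?_
  rw [ht20]; norm_num

/-- **Explicit-constant floor inside the family**: for `θ ≤ 29/20` it is false that
`q^k < rad(1·(q^k−1)·q^k)^θ` for all primes `q` and all `k ≥ 1` — witness `(q, k) = (7, 4)`,
`2401 ≥ 210^{29/20} ≥ 210^θ`. (The family's quality record `1.4557…`; with a free constant `C(q,ε)` this says
nothing, with `C = 1` it forces the exponent above `1.4557`.) [folklore] -/
theorem not_const_one_of_exponent_le {θ : ℝ} (hθ : θ ≤ 29 / 20) :
    ¬ ∀ q : ℕ, q.Prime → ∀ k : ℕ, 1 ≤ k →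
      ((q ^ k : ℕ) : ℝ) < ((rad 1 (q ^ k - 1) (q ^ k) : ℕ) : ℝ) ^ θ := by
  intro h
  have h1 := h 7 (by norm_num) 4 (by norm_num)
  have hrad : ((rad 1 (7 ^ 4 - 1) (7 ^ 4) : ℕ) : ℝ) = 210 := by
    have e : rad 1 (7 ^ 4 - 1) (7 ^ 4) = rad 1 2400 2401 := by norm_num
    rw [e, rad_one_2400_2401]; norm_num
  have h74 : ((7 ^ 4 : ℕ) : ℝ) = 2401 := by norm_num
  rw [hrad, h74] at h1
  have hmono : (210 : ℝ) ^ θ ≤ (210 : ℝ) ^ ((29 : ℝ) / 20) :=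
    Real.rpow_le_rpow_of_exponent_le (by norm_num) hθ
  have := rpow_210_lt_2401
  linarith

end Summit.ABC.ABC.Theorems.PrimePowerRadical.Negative

end
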